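import Summits.Ventures.PercRepro.S2ClusterLeverB
import Summits.Ventures.PercRepro.S2TwoSetCount

/-!
# PercRepro — S2: THE CLUSTERS AT `t ≥ 4` — FIVE SHAPES WITHOUT THREE PAIRWISE DISJOINT TRIANGLES (p7, gen 15; sub-claim S2)

With `t ≥ 4` triangles and no three pairwise disjoint ones, either some triangle is met by three others — a `6`-point cluster
of nullity `3` (**shape A**, `ncard_cluster_le_six_of_three_meeting`) — or a disjoint pair `E₁, E₂` carries every other
triangle with `|N(E₁)| + |N(E₂)| ≥ t − 2`, both `≤ 2`, and the two clusters are disjoint with sizes / nullities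
`(≤ 7, 3) + (≤ 3, 1)` (**B**), `(≤ 7, 3) + (≤ 5, 2)` (**C**), `(≤ 7, 3) + (≤ 7, 3)` (**D**) or `(≤ 5, 2) + (≤ 5, 2)` (**E**; disjoint by
Lemma U on the four triangles: a shared point would give `≤ 9` points of nullity `≥ 4`): **`exists_clusters_of_no_three_disjoint_four`**.
With the nullity lever and the two-set count (`S2.ncard_subsets_inter_ge_two_le`) every shape bounds the top count at corank `6`,
`n = 19`, by `13350` (**`top_count_le_of_clusters_four`**: A `6969 + 6051`, B `5873 + 7371`, C `3150 + 5635`, D `1225 + 3675`,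
E `5600 + 7750`). Nothing about any cell is claimed. Axioms: standard.
-/

open scoped Matroid

namespace PercRepro

namespace S2

open Set

variable {α : Type}

/-- **The five shapes at `t ≥ 4`.** -/
theorem exists_clusters_of_no_three_disjoint_four (M : Matroid α) [M.Finite]
    (hC1 : ∀ L ⊆ M.E, M.eRk L = 2 → L.ncard ≤ 3)
    (h9 : ∀ X ⊆ M.E, X.ncard ≤ 9 → X.encard ≤ M.eRk X + 3)
    (ht4 : 4 ≤ {C : Set α | M.IsCircuit C ∧ C.ncard = 3}.ncard)
    (hno : ¬ ∃ T₁ T₂ T₃ : Set α, M.IsCircuit T₁ ∧ T₁.ncard = 3 ∧ M.IsCircuit T₂ ∧ T₂.ncard = 3 ∧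
      M.IsCircuit T₃ ∧ T₃.ncard = 3 ∧ Disjoint T₁ T₂ ∧ Disjoint T₁ T₃ ∧ Disjoint T₂ T₃) :
    (∃ W₁ : Set α, W₁ ⊆ M.E ∧ W₁.ncard ≤ 6 ∧ M.eRk W₁ + 3 ≤ W₁.encard) ∨
    (∃ W₁ W₂ : Set α, ∃ k₁ k₂ : ℕ, W₁ ⊆ M.E ∧ W₂ ⊆ M.E ∧ Disjoint W₁ W₂ ∧
      M.eRk W₁ + k₁ ≤ W₁.encard ∧ M.eRk W₂ + k₂ ≤ W₂.encard ∧
      ((W₁.ncard ≤ 7 ∧ k₁ = 3 ∧ W₂.ncard ≤ 3 ∧ k₂ = 1) ∨ (W₁.ncard ≤ 7 ∧ k₁ = 3 ∧ W₂.ncard ≤ 5 ∧ k₂ = 2) ∨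
        (W₁.ncard ≤ 7 ∧ k₁ = 3 ∧ W₂.ncard ≤ 7 ∧ k₂ = 3) ∨ (W₁.ncard ≤ 5 ∧ k₁ = 2 ∧ W₂.ncard ≤ 5 ∧ k₂ = 2))) := by
  classical
  set 𝒯 := {C : Set α | M.IsCircuit C ∧ C.ncard = 3} with h𝒯
  have h𝒯fin : 𝒯.Finite := M.ground_finite.finite_subsets.subset (fun C hC => hC.1.subset_ground)
  have hfinT : ∀ {T : Set α}, M.IsCircuit T → T.Finite := fun hT => M.ground_finite.subset hT.subset_ground
  -- a triangle has nullity `1`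
  have hnul1 : ∀ {T : Set α}, M.IsCircuit T → M.eRk T + 1 ≤ T.encard := fun hT => le_of_eq hT.eRk_add_one_eq
  -- SHAPE A from three triangles meeting a triangle `E`
  have shapeA : ∀ {E : Set α}, M.IsCircuit E → E.ncard = 3 →
      3 ≤ {C : Set α | M.IsCircuit C ∧ C.ncard = 3 ∧ C ≠ E ∧ ¬ Disjoint C E}.ncard →
      ∃ W₁ : Set α, W₁ ⊆ M.E ∧ W₁.ncard ≤ 6 ∧ M.eRk W₁ + 3 ≤ W₁.encard := by
    intro E hE hE3 h3
    have hNfin : {C : Set α | M.IsCircuit C ∧ C.ncard = 3 ∧ C ≠ E ∧ ¬ Disjoint C E}.Finite :=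
      h𝒯fin.subset (fun C hC => ⟨hC.1, hC.2.1⟩)
    obtain ⟨F₁, F₂, F₃, hF₁, hF₂, hF₃, h12, h13, h23⟩ := (Set.two_lt_ncard_iff hNfin).1 (by omega)
    obtain ⟨-, hW3⟩ := cluster_of_two_meeting M hC1 hE hE3 hF₁.1 hF₁.2.1 hF₁.2.2.1 hF₁.2.2.2
      hF₂.1 hF₂.2.1 hF₂.2.2.1 hF₂.2.2.2 h12
    refine ⟨E ∪ F₁ ∪ F₂, Set.union_subset (Set.union_subset hE.subset_ground hF₁.1.subset_ground) hF₂.1.subset_ground,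
      ncard_cluster_le_six_of_three_meeting M hC1 h9 hE hE3 hF₁.1 hF₁.2.1 hF₁.2.2.1 hF₁.2.2.2
        hF₂.1 hF₂.2.1 hF₂.2.2.1 hF₂.2.2.2 hF₃.1 hF₃.2.1 hF₃.2.2.1 hF₃.2.2.2 h13 h23, hW3⟩
  -- a first triangle and the triangles disjoint from it
  obtain ⟨E₁, hE₁⟩ : 𝒯.Nonempty := Set.nonempty_of_ncard_ne_zero (by omega)
  set 𝒟₁ := {C : Set α | M.IsCircuit C ∧ C.ncard = 3 ∧ Disjoint C E₁} with h𝒟₁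
  have h𝒟₁fin : 𝒟₁.Finite := h𝒯fin.subset (fun C hC => ⟨hC.1, hC.2.1⟩)
  set 𝒩₁ := {C : Set α | M.IsCircuit C ∧ C.ncard = 3 ∧ C ≠ E₁ ∧ ¬ Disjoint C E₁} with h𝒩₁
  have h𝒩₁fin : 𝒩₁.Finite := h𝒯fin.subset (fun C hC => ⟨hC.1, hC.2.1⟩)
  have hN₁3 : 𝒩₁.ncard ≤ 3 := ncard_triangles_meeting_le_three M hC1 h9 hE₁.1 hE₁.2
  have hcover : 𝒯 ⊆ ({E₁} ∪ 𝒩₁) ∪ 𝒟₁ := by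
    intro C hC
    by_cases hne : C = E₁
    · exact Or.inl (Or.inl (Set.mem_singleton_iff.2 hne))
    by_cases hdis : Disjoint C E₁
    · exact Or.inr ⟨hC.1, hC.2, hdis⟩
    · exact Or.inl (Or.inr ⟨hC.1, hC.2, hne, hdis⟩)
  have hle1 := Set.ncard_le_ncard hcover (((Set.finite_singleton E₁).union h𝒩₁fin).union h𝒟₁fin)
  have hu1 := Set.ncard_union_le ({E₁} ∪ 𝒩₁) 𝒟₁
  have hu2 := Set.ncard_union_le ({E₁} : Set (Set α)) 𝒩₁
  rw [Set.ncard_singleton] at hu2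
  by_cases hD : 𝒟₁.ncard = 0
  · -- every other triangle meets `E₁`: shape A
    have h3 : 3 ≤ 𝒩₁.ncard := by omega
    exact Or.inl (shapeA hE₁.1 hE₁.2 h3)
  obtain ⟨E₂, hE₂⟩ : 𝒟₁.Nonempty := Set.nonempty_of_ncard_ne_zero hD
  set 𝒩₂ := {C : Set α | M.IsCircuit C ∧ C.ncard = 3 ∧ C ≠ E₂ ∧ ¬ Disjoint C E₂} with h𝒩₂
  have h𝒩₂fin : 𝒩₂.Finite := h𝒯fin.subset (fun C hC => ⟨hC.1, hC.2.1⟩)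
  have hN₂3 : 𝒩₂.ncard ≤ 3 := ncard_triangles_meeting_le_three M hC1 h9 hE₂.1 hE₂.2.1
  have hcover2 : 𝒟₁ ⊆ {E₂} ∪ 𝒩₂ := by
    intro C hC
    by_cases hne : C = E₂
    · exact Or.inl (Set.mem_singleton_iff.2 hne)
    refine Or.inr ⟨hC.1, hC.2.1, hne, fun hdis => hno ⟨E₁, C, E₂, hE₁.1, hE₁.2, hC.1, hC.2.1, hE₂.1, hE₂.2.1,
      hC.2.2.symm, hE₂.2.2.symm, hdis⟩⟩
  have hle2 := Set.ncard_le_ncard hcover2 ((Set.finite_singleton E₂).union h𝒩₂fin)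
  have hu3 := Set.ncard_union_le ({E₂} : Set (Set α)) 𝒩₂
  rw [Set.ncard_singleton] at hu3
  -- shape A if three triangles meet `E₁` or `E₂`
  by_cases hN₁ge3 : 3 ≤ 𝒩₁.ncard
  · exact Or.inl (shapeA hE₁.1 hE₁.2 hN₁ge3)
  by_cases hN₂ge3 : 3 ≤ 𝒩₂.ncard
  · exact Or.inl (shapeA hE₂.1 hE₂.2.1 hN₂ge3)
  push Not at hN₁ge3 hN₂ge3
  right
  -- the generic pieces
  have hdisj_of_cluster : ∀ {E F₁ F₂ : Set α}, M.IsCircuit E → E.ncard = 3 →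
      M.IsCircuit F₁ → F₁.ncard = 3 → F₁ ≠ E → ¬ Disjoint F₁ E →
      M.IsCircuit F₂ → F₂.ncard = 3 → F₂ ≠ E → ¬ Disjoint F₂ E → F₁ ≠ F₂ →
      ∀ {E' : Set α}, M.IsCircuit E' → E'.ncard = 3 → Disjoint E' E → Disjoint E' (E ∪ F₁ ∪ F₂) := by
    intro E F₁ F₂ hE hE3 hF₁ hF₁3 hF₁E hF₁m hF₂ hF₂3 hF₂E hF₂m h12 E' hE' hE'3 hdis
    obtain ⟨hW7, hW3⟩ := cluster_of_two_meeting M hC1 hE hE3 hF₁ hF₁3 hF₁E hF₁m hF₂ hF₂3 hF₂E hF₂m h12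
    have hWE : E ∪ F₁ ∪ F₂ ⊆ M.E :=
      Set.union_subset (Set.union_subset hE.subset_ground hF₁.subset_ground) hF₂.subset_ground
    rcases triangle_subset_or_disjoint_of_cluster M h9 hWE hW7 hW3 hE' hE'3 with h | h
    · exact absurd h (not_subset_cluster_of_disjoint M hC1 hF₁ hF₁3 hF₁m hF₂ hF₂3 hF₂m hE' hE'3 hdis)
    · exact h
  have hdisj_meet : ∀ {W E' G : Set α}, W ⊆ M.E → W.ncard ≤ 7 → M.eRk W + 3 ≤ W.encard → Disjoint E' W →
      M.IsCircuit G → G.ncard = 3 → ¬ Disjoint G E' → Disjoint G W := by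
    intro W E' G hWE hW7 hW3 hE'W hG hG3 hGm
    rcases triangle_subset_or_disjoint_of_cluster M h9 hWE hW7 hW3 hG hG3 with h | h
    · exfalso
      obtain ⟨x, hxG, hxE'⟩ := Set.not_disjoint_iff.1 hGm
      exact Set.disjoint_left.1 hE'W hxE' (h hxG)
    · exact h
  -- a member of `𝒩₂` meets `E₂`; if it met `E₁` too it would be in `𝒩₁`, so with `𝒩₁ ∩ 𝒩₂ = ∅` …: we keep the cases simple
  have hsum : 2 ≤ 𝒩₁.ncard + 𝒩₂.ncard := by omega
  -- CASE |𝒩₁| = 2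
  by_cases hN₁2 : 𝒩₁.ncard = 2
  · obtain ⟨F₁, F₂, hF₁, hF₂, h12⟩ := (Set.one_lt_ncard_iff h𝒩₁fin).1 (by omega)
    obtain ⟨hW₁7, hW₁3⟩ := cluster_of_two_meeting M hC1 hE₁.1 hE₁.2 hF₁.1 hF₁.2.1 hF₁.2.2.1 hF₁.2.2.2
      hF₂.1 hF₂.2.1 hF₂.2.2.1 hF₂.2.2.2 h12
    set W₁ := E₁ ∪ F₁ ∪ F₂ with hW₁
    have hW₁E : W₁ ⊆ M.E :=
      Set.union_subset (Set.union_subset hE₁.1.subset_ground hF₁.1.subset_ground) hF₂.1.subset_ground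
    have hE₂W₁ : Disjoint E₂ W₁ := hdisj_of_cluster hE₁.1 hE₁.2 hF₁.1 hF₁.2.1 hF₁.2.2.1 hF₁.2.2.2
      hF₂.1 hF₂.2.1 hF₂.2.2.1 hF₂.2.2.2 h12 hE₂.1 hE₂.2.1 hE₂.2.2
    have hGW₁ : ∀ {G : Set α}, G ∈ 𝒩₂ → Disjoint G W₁ := fun hG =>
      hdisj_meet hW₁E hW₁7 hW₁3 hE₂W₁ hG.1 hG.2.1 hG.2.2.2
    by_cases hN₂2 : 𝒩₂.ncard = 2
    · obtain ⟨G₁, G₂, hG₁, hG₂, hg12⟩ := (Set.one_lt_ncard_iff h𝒩₂fin).1 (by omega)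
      obtain ⟨hW₂7, hW₂3⟩ := cluster_of_two_meeting M hC1 hE₂.1 hE₂.2.1 hG₁.1 hG₁.2.1 hG₁.2.2.1 hG₁.2.2.2
        hG₂.1 hG₂.2.1 hG₂.2.2.1 hG₂.2.2.2 hg12
      exact ⟨W₁, E₂ ∪ G₁ ∪ G₂, 3, 3, hW₁E,
        Set.union_subset (Set.union_subset hE₂.1.subset_ground hG₁.1.subset_ground) hG₂.1.subset_ground,
        (Set.disjoint_union_left.2 ⟨Set.disjoint_union_left.2 ⟨hE₂W₁, hGW₁ hG₁⟩, hGW₁ hG₂⟩).symm, hW₁3, hW₂3,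
        Or.inr (Or.inr (Or.inl ⟨hW₁7, rfl, hW₂7, rfl⟩))⟩
    by_cases hN₂1 : 𝒩₂.ncard = 1
    · obtain ⟨G₁, hG₁⟩ : 𝒩₂.Nonempty := Set.nonempty_of_ncard_ne_zero (by omega)
      obtain ⟨hW₂5, hW₂2⟩ := cluster_of_one_meeting M hC1 hE₂.1 hE₂.2.1 hG₁.1 hG₁.2.1 hG₁.2.2.1 hG₁.2.2.2
      exact ⟨W₁, E₂ ∪ G₁, 3, 2, hW₁E, Set.union_subset hE₂.1.subset_ground hG₁.1.subset_ground,
        (Set.disjoint_union_left.2 ⟨hE₂W₁, hGW₁ hG₁⟩).symm, hW₁3, hW₂2,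
        Or.inr (Or.inl ⟨hW₁7, rfl, hW₂5, rfl⟩)⟩
    · exact ⟨W₁, E₂, 3, 1, hW₁E, hE₂.1.subset_ground, hE₂W₁.symm, hW₁3, hnul1 hE₂.1,
        Or.inl ⟨hW₁7, rfl, hE₂.2.1.le, rfl⟩⟩
  -- CASE |𝒩₂| = 2 (and |𝒩₁| ≤ 1): the cluster on `E₂`
  by_cases hN₂2 : 𝒩₂.ncard = 2
  · obtain ⟨G₁, G₂, hG₁, hG₂, hg12⟩ := (Set.one_lt_ncard_iff h𝒩₂fin).1 (by omega)
    obtain ⟨hW₂7, hW₂3⟩ := cluster_of_two_meeting M hC1 hE₂.1 hE₂.2.1 hG₁.1 hG₁.2.1 hG₁.2.2.1 hG₁.2.2.2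
      hG₂.1 hG₂.2.1 hG₂.2.2.1 hG₂.2.2.2 hg12
    set W₂ := E₂ ∪ G₁ ∪ G₂ with hW₂
    have hW₂E : W₂ ⊆ M.E :=
      Set.union_subset (Set.union_subset hE₂.1.subset_ground hG₁.1.subset_ground) hG₂.1.subset_ground
    have hE₁W₂ : Disjoint E₁ W₂ := hdisj_of_cluster hE₂.1 hE₂.2.1 hG₁.1 hG₁.2.1 hG₁.2.2.1 hG₁.2.2.2
      hG₂.1 hG₂.2.1 hG₂.2.2.1 hG₂.2.2.2 hg12 hE₁.1 hE₁.2 hE₂.2.2.symm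
    by_cases hN₁1 : 𝒩₁.ncard = 1
    · obtain ⟨F₁, hF₁⟩ : 𝒩₁.Nonempty := Set.nonempty_of_ncard_ne_zero (by omega)
      have hF₁W₂ : Disjoint F₁ W₂ := hdisj_meet hW₂E hW₂7 hW₂3 hE₁W₂ hF₁.1 hF₁.2.1 hF₁.2.2.2
      obtain ⟨hW₁5, hW₁2⟩ := cluster_of_one_meeting M hC1 hE₁.1 hE₁.2 hF₁.1 hF₁.2.1 hF₁.2.2.1 hF₁.2.2.2
      exact ⟨W₂, E₁ ∪ F₁, 3, 2, hW₂E, Set.union_subset hE₁.1.subset_ground hF₁.1.subset_ground,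
        (Set.disjoint_union_left.2 ⟨hE₁W₂, hF₁W₂⟩).symm, hW₂3, hW₁2, Or.inr (Or.inl ⟨hW₂7, rfl, hW₁5, rfl⟩)⟩
    · exact ⟨W₂, E₁, 3, 1, hW₂E, hE₁.1.subset_ground, hE₁W₂.symm, hW₂3, hnul1 hE₁.1,
        Or.inl ⟨hW₂7, rfl, hE₁.2.le, rfl⟩⟩
  -- CASE |𝒩₁| = |𝒩₂| = 1: two small clusters, disjoint by Lemma U
  have hN₁1 : 𝒩₁.ncard = 1 := by omega
  have hN₂1 : 𝒩₂.ncard = 1 := by omega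
  obtain ⟨F₁, hF₁⟩ : 𝒩₁.Nonempty := Set.nonempty_of_ncard_ne_zero (by omega)
  obtain ⟨G₁, hG₁⟩ : 𝒩₂.Nonempty := Set.nonempty_of_ncard_ne_zero (by omega)
  obtain ⟨hW₁5, hW₁2⟩ := cluster_of_one_meeting M hC1 hE₁.1 hE₁.2 hF₁.1 hF₁.2.1 hF₁.2.2.1 hF₁.2.2.2
  obtain ⟨hW₂5, hW₂2⟩ := cluster_of_one_meeting M hC1 hE₂.1 hE₂.2.1 hG₁.1 hG₁.2.1 hG₁.2.2.1 hG₁.2.2.2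
  -- `F₁` does not meet `E₂` and `G₁` does not meet `E₁` (else the two singletons coincide and `t ≤ 3`)
  have hN₁eq : 𝒩₁ = {F₁} := by
    have h1 : ({F₁} : Set (Set α)) ⊆ 𝒩₁ := Set.singleton_subset_iff.2 hF₁
    exact (Set.eq_of_subset_of_ncard_le h1 (by rw [Set.ncard_singleton, hN₁1]) h𝒩₁fin).symm
  have hN₂eq : 𝒩₂ = {G₁} := by
    have h1 : ({G₁} : Set (Set α)) ⊆ 𝒩₂ := Set.singleton_subset_iff.2 hG₁
    exact (Set.eq_of_subset_of_ncard_le h1 (by rw [Set.ncard_singleton, hN₂1]) h𝒩₂fin).symm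
  have ht3 : G₁ = F₁ → False := by
    intro hGF
    -- `𝒯 ⊆ {E₁, F₁, E₂}`
    have hsub : 𝒯 ⊆ ({E₁} ∪ {F₁}) ∪ {E₂} := fun C hC => by
      rcases hcover hC with (h | h) | h
      · exact Or.inl (Or.inl h)
      · rw [hN₁eq] at h; exact Or.inl (Or.inr h)
      · rcases hcover2 h with h' | h'
        · exact Or.inr h'
        · rw [hN₂eq, hGF] at h'; exact Or.inl (Or.inr h')
    have hle := Set.ncard_le_ncard hsub (((Set.finite_singleton E₁).union (Set.finite_singleton F₁)).union
      (Set.finite_singleton E₂))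
    have hu4 := Set.ncard_union_le ({E₁} ∪ {F₁} : Set (Set α)) {E₂}
    have hu5 := Set.ncard_union_le ({E₁} : Set (Set α)) {F₁}
    rw [Set.ncard_singleton] at hu4 hu5
    rw [Set.ncard_singleton] at hu5
    omega
  have hF₁E₂ : Disjoint F₁ E₂ := by
    by_contra hm
    have hmem : F₁ ∈ 𝒩₂ := ⟨hF₁.1, hF₁.2.1, fun h => hF₁.2.2.2 (h ▸ hE₂.2.2), hm⟩
    rw [hN₂eq] at hmem
    exact ht3 (Set.mem_singleton_iff.1 hmem).symm
  have hG₁E₁ : Disjoint G₁ E₁ := by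
    by_contra hm
    have hmem : G₁ ∈ 𝒩₁ := ⟨hG₁.1, hG₁.2.1, fun h => hG₁.2.2.2 (h ▸ hE₂.2.2.symm), hm⟩
    rw [hN₁eq] at hmem
    exact ht3 (Set.mem_singleton_iff.1 hmem)
  -- the four triangles: a shared point of the two clusters would give `≤ 9` points of nullity `≥ 4`
  have hdisW : Disjoint (E₁ ∪ F₁) (E₂ ∪ G₁) := by
    by_contra hnd
    have hE₁f := hfinT hE₁.1
    have hE₂f := hfinT hE₂.1
    have hF₁f := hfinT hF₁.1
    have hG₁f := hfinT hG₁.1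
    -- `F₁ ⊄ E₁ ∪ E₂`, `G₁ ⊄ E₁ ∪ E₂ ∪ F₁`
    have hF₁n : ¬ F₁ ⊆ E₁ ∪ E₂ := by
      intro hsub
      have h : F₁ \ E₁ ⊆ F₁ ∩ E₂ := fun y hy => ⟨hy.1, (hsub hy.1).resolve_left hy.2⟩
      have h2 := ncard_sdiff_eq_two_of_triangles_meeting M hC1 hE₁.1 hE₁.2 hF₁.1 hF₁.2.1 hF₁.2.2.1 hF₁.2.2.2
      have h3 := Set.ncard_le_ncard h (hF₁f.subset Set.inter_subset_left)
      have h4 : (F₁ ∩ E₂).ncard = 0 := by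
        rw [Set.ncard_eq_zero (hF₁f.subset Set.inter_subset_left)]
        exact Set.disjoint_iff_inter_eq_empty.1 hF₁E₂
      omega
    have hG₁n : ¬ G₁ ⊆ E₁ ∪ E₂ ∪ F₁ := by
      intro hsub
      have h : G₁ \ E₂ ⊆ G₁ ∩ F₁ := fun y hy => by
        refine ⟨hy.1, ?_⟩
        rcases hsub hy.1 with (h1 | h2) | h3
        · exact absurd (Set.mem_inter hy.1 h1) (by rw [Set.disjoint_iff_inter_eq_empty.1 hG₁E₁]; exact id)
        · exact absurd h2 hy.2
        · exact h3
      have h2 := ncard_sdiff_eq_two_of_triangles_meeting M hC1 hE₂.1 hE₂.2.1 hG₁.1 hG₁.2.1 hG₁.2.2.1 hG₁.2.2.2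
      have h3 := Set.ncard_le_ncard h (hG₁f.subset Set.inter_subset_left)
      have hne : G₁ ≠ F₁ := fun h => ht3 h
      have h1 := ncard_inter_le_one_of_triangles M hC1 hG₁.1 hG₁.2.1 hF₁.1 hF₁.2.1 hne
      omega
    have hne12 : E₁ ≠ E₂ := by
      intro h
      have hd := hE₂.2.2
      rw [← h] at hd
      have hemp : E₁ = ∅ := by
        rw [← Set.inter_self E₁]
        exact Set.disjoint_iff_inter_eq_empty.1 hd
      have := hE₁.2
      rw [hemp, Set.ncard_empty] at this
      omega
    have hU := eRk_union_four_add_four_le_encard M hE₁.1 hE₂.1 hF₁.1 hG₁.1 hne12 hF₁n hG₁n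
    -- the union has `≤ 9` points
    have hXeq : E₁ ∪ E₂ ∪ F₁ ∪ G₁ = (E₁ ∪ F₁) ∪ (E₂ ∪ G₁) := by
      ext y; simp only [Set.mem_union]; tauto
    have hX9 : (E₁ ∪ E₂ ∪ F₁ ∪ G₁).ncard ≤ 9 := by
      rw [hXeq]
      have h1 := Set.ncard_union_add_ncard_inter (E₁ ∪ F₁) (E₂ ∪ G₁) (hE₁f.union hF₁f) (hE₂f.union hG₁f)
      obtain ⟨x, hx1, hx2⟩ := Set.not_disjoint_iff.1 hnd
      have h2 : 0 < ((E₁ ∪ F₁) ∩ (E₂ ∪ G₁)).ncard :=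
        (Set.ncard_pos ((hE₁f.union hF₁f).subset Set.inter_subset_left)).2 ⟨x, hx1, hx2⟩
      omega
    have hXE : E₁ ∪ E₂ ∪ F₁ ∪ G₁ ⊆ M.E :=
      Set.union_subset (Set.union_subset (Set.union_subset hE₁.1.subset_ground hE₂.1.subset_ground)
        hF₁.1.subset_ground) hG₁.1.subset_ground
    have h9X := h9 _ hXE hX9
    obtain ⟨r, hr⟩ := ENat.ne_top_iff_exists.1 (eRk_ne_top_of_finite (M := M) hXE)
    rw [← hr] at hU h9X
    have hbad : (r : ℕ∞) + 4 ≤ r + 3 := hU.trans h9X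
    have : r + 4 ≤ r + 3 := by exact_mod_cast hbad
    omega
  exact ⟨E₁ ∪ F₁, E₂ ∪ G₁, 2, 2, Set.union_subset hE₁.1.subset_ground hF₁.1.subset_ground,
    Set.union_subset hE₂.1.subset_ground hG₁.1.subset_ground, hdisW, hW₁2, hW₂2,
    Or.inr (Or.inr (Or.inr ⟨hW₁5, rfl, hW₂5, rfl⟩))⟩

/-- **The top sets against two disjoint clusters, the two-set count** (corank `6`): `U6 ≤ ΣΣ_{i ≥ k₁, j ≥ k₂}`,
`U5 ≤ ΣΣ_{i ≥ k₁ − 1, j ≥ k₂ − 1}` of `C(|W₁|, i) · C(|W₂|, j) · C(p + 6 − |W₁| − |W₂|, m − i − j)`. -/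
theorem top_sets_le_of_two_clusters (M : Matroid α) [M.Finite] {p : ℕ} (hR : M.eRank = (p : ℕ∞)) (hn : M.E.ncard = p + 6)
    {W₁ W₂ : Set α} {k₁ k₂ : ℕ} (hW₁ : W₁ ⊆ M.E) (hW₂ : W₂ ⊆ M.E) (hdis : Disjoint W₁ W₂)
    (hk₁ : M.eRk W₁ + k₁ ≤ W₁.encard) (hk₂ : M.eRk W₂ + k₂ ≤ W₂.encard) :
    {B : Set α | B ⊆ M.E ∧ B.ncard = 6 ∧ M.eRk B = 5 ∧ M.eRk (M.E \ B) = M.eRank}.ncard ≤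
        ∑ i ∈ Finset.Icc k₁ 6, ∑ j ∈ Finset.Icc k₂ (6 - i),
          W₁.ncard.choose i * (W₂.ncard.choose j * ((p + 6) - W₁.ncard - W₂.ncard).choose (6 - i - j)) ∧
      {B : Set α | B ⊆ M.E ∧ B.ncard = 5 ∧ M.eRk B = 5 ∧ M.eRk (M.E \ B) = M.eRank}.ncard ≤
        ∑ i ∈ Finset.Icc (k₁ - 1) 5, ∑ j ∈ Finset.Icc (k₂ - 1) (5 - i),
          W₁.ncard.choose i * (W₂.ncard.choose j * ((p + 6) - W₁.ncard - W₂.ncard).choose (5 - i - j)) := by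
  classical
  have hEfin := M.ground_finite
  have hW₁fin : W₁.Finite := hEfin.subset hW₁
  have hW₂fin : W₂.Finite := hEfin.subset hW₂
  have hW₁F : hW₁fin.toFinset ⊆ hEfin.toFinset := Set.Finite.toFinset_subset_toFinset.2 hW₁
  have hW₂F : hW₂fin.toFinset ⊆ hEfin.toFinset := Set.Finite.toFinset_subset_toFinset.2 hW₂
  have hdisF : Disjoint hW₁fin.toFinset hW₂fin.toFinset := by
    rw [Set.Finite.disjoint_toFinset]; exact hdis
  have hW₁card : hW₁fin.toFinset.card = W₁.ncard := (Set.ncard_eq_toFinset_card W₁ hW₁fin).symm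
  have hW₂card : hW₂fin.toFinset.card = W₂.ncard := (Set.ncard_eq_toFinset_card W₂ hW₂fin).symm
  have hEcard : hEfin.toFinset.card = p + 6 := by rw [← Set.ncard_eq_toFinset_card _ hEfin]; exact hn
  constructor
  · have hsub : {B : Set α | B ⊆ M.E ∧ B.ncard = 6 ∧ M.eRk B = 5 ∧ M.eRk (M.E \ B) = M.eRank} ⊆
        {X : Set α | X ⊆ (hEfin.toFinset : Set α) ∧ X.ncard = 6 ∧ k₁ ≤ (X ∩ (hW₁fin.toFinset : Set α)).ncard ∧
          k₂ ≤ (X ∩ (hW₂fin.toFinset : Set α)).ncard} := by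
      rintro B ⟨hBE, hB6, -, hBs⟩
      refine ⟨by rw [Set.Finite.coe_toFinset]; exact hBE, hB6, ?_, ?_⟩
      · rw [Set.Finite.coe_toFinset]; exact cobasis_inter_ge_of_nullity M hR hn hBE hB6 hBs hW₁ hk₁
      · rw [Set.Finite.coe_toFinset]; exact cobasis_inter_ge_of_nullity M hR hn hBE hB6 hBs hW₂ hk₂
    have hle := Set.ncard_le_ncard hsub ((hEfin.toFinset.finite_toSet.finite_subsets).subset (fun X hX => hX.1))
    have hc := ncard_subsets_inter_ge_two_le hEfin.toFinset hW₁fin.toFinset hW₂fin.toFinset hW₁F hW₂F hdisF 6 k₁ k₂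
    rw [hW₁card, hW₂card, hEcard] at hc
    exact hle.trans hc
  · have hsub : {B : Set α | B ⊆ M.E ∧ B.ncard = 5 ∧ M.eRk B = 5 ∧ M.eRk (M.E \ B) = M.eRank} ⊆
        {X : Set α | X ⊆ (hEfin.toFinset : Set α) ∧ X.ncard = 5 ∧ k₁ - 1 ≤ (X ∩ (hW₁fin.toFinset : Set α)).ncard ∧
          k₂ - 1 ≤ (X ∩ (hW₂fin.toFinset : Set α)).ncard} := by
      rintro B ⟨hBE, hB5, -, hBs⟩
      refine ⟨by rw [Set.Finite.coe_toFinset]; exact hBE, hB5, ?_, ?_⟩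
      · rw [Set.Finite.coe_toFinset]
        have := top_five_inter_ge_of_nullity M hR hn hBE hB5 hBs hW₁ hk₁; omega
      · rw [Set.Finite.coe_toFinset]
        have := top_five_inter_ge_of_nullity M hR hn hBE hB5 hBs hW₂ hk₂; omega
    have hle := Set.ncard_le_ncard hsub ((hEfin.toFinset.finite_toSet.finite_subsets).subset (fun X hX => hX.1))
    have hc := ncard_subsets_inter_ge_two_le hEfin.toFinset hW₁fin.toFinset hW₂fin.toFinset hW₁F hW₂F hdisF 5 (k₁ - 1) (k₂ - 1)
    rw [hW₁card, hW₂card, hEcard] at hc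
    exact hle.trans hc

end S2

end PercRepro
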